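import Mathlib
import Literature.Analysis.FluidPDE.Tao2016AveragedNS.ShiftSetCascadeFlows
import Summits.NavierStokesRegularity.NavierStokesRegularity.Theorems.TaoLadderRungTwoFlatCertificateGlueTruncFlowPerCompOn
import Summits.NavierStokesRegularity.NavierStokesRegularity.Theorems.TaoLadderRungTwoFlatCertificateGlueCodeListOn
import Summits.NavierStokesRegularity.NavierStokesRegularity.Theorems.TaylorModelRungThreeCertificateIntervalDJets
import HarnessLib

/-!
# Certificate glue on a shift set `𝕊`, XXIV: THE CHECKER'S FIELD — the rounded-dyadic INTERVAL TWIN `pqBox` of the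
  truncated window field `PQcN` (per-component weighted coordinates) and its soundness `isFieldEnclosure_pqBox`,
  plus the jet corollary (helper for items stmt-NavierStokesRegularity-22987 `FlatGapCertificatesV2` (crux K_A♭ of route
  TaoLadderRungTwoFlat) and stmt-24295 K_A₂(64); cell harvest/h2-tao-ladder, p1 g15; CHECKER-SPEC-v3 §3 (i))

First brick of the COMPUTABLE checker for the Lohner-step clauses of glue XIX-c, XIX-d, XIX-e (`stepCert_of_plohner_*`): the field
`PQcN 𝕊 ε₀ α Kb Ka ω` evaluated in pub-ns-dss's outward-rounded dyadic interval arithmetic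
(`…Theorems.TaylorModelCert.IntervalD`, relative precision `prec`). Per target coordinate `d ↔ (i, k)` the twin is the
rounded sum over `(i₁, i₂, μ) ∈ Fin m × Fin m × shifts` of `coefB · U(idx(i₁,a)) · W(idx(i₂,b))`
(`a = k−μ₃+μ₁`, `b = k−μ₃+μ₂`; the zero box when a factor is off the window), where the COEFFICIENT BOXES `coefB` are
data required to contain `α i₁ i₂ i μ · (1+ε₀)^{5(k−μ₃)/2} · ω i₁ a · ω i₂ b / ω i k` (`CoefBoxOK`) — the per-component
weights are folded into the coefficients, so the twin costs the same for any weight table.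

* `sumBoxes`, `mem_sumBoxes` — rounded list sums; `truncAt_pwstate_of_mem/_of_not` — the weighted coordinate reader;
* `pcoef`, `CoefBoxOK`, `termBox`, `pqBox`;
* `mem_pqBox` / `isFieldEnclosure_pqBox` — `PQcN x y d ∈ pqBox U W d` whenever `x ∈ U`, `y ∈ W` coordinatewise
  (`𝕊 = shifts.toFinset`, no duplicates): an `IsFieldEnclosure` in the sense of `…TaylorModelCert.IntervalD`;
* `mem_taylorJet_pqBox` — hence (pub-ns-dss's generic `mem_jet_of_isJetEnclosure`) every jet-enclosure family built
  with `pqBox` encloses the Taylor jets `taylorJet (PQcN …) y k` of every point of its level-0 box — the input of the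
  clauses C4/C5 (`TPoly`, `VPoly`) of the step checker.

HONEST FRAMING: Tao-type MODEL lattices (Tao 2016 §4/§6 vocabulary, shift-set parametrised); interval-arithmetic
soundness lemmas about an explicit polynomial field — no certificate data, nothing certified, no stub closed, nothing about
the Navier–Stokes equations.
-/

-- the sub-problem namespace repeats the summit name by design (D-0017)
set_option linter.dupNamespace false

namespace Summit.NavierStokesRegularity.NavierStokesRegularity.Theorems

open Set Finset Literature.Analysis.FluidPDE Literature.Analysis.FluidPDE.TaoCascade
open Summit.NavierStokesRegularity.NavierStokesRegularity.Theorems.TaylorModelCert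
open Summit.NavierStokesRegularity.NavierStokesRegularity.Theorems.TaylorModelReadout

namespace CertificateGlueOn

variable {m : ℕ} {Kb Ka : ℤ}

/-! ### Rounded list sums -/

/-- Rounded sum of a list of boxes (right fold, `roundOut prec` after each addition). [folklore] -/
def sumBoxes (prec : ℕ) : List IntervalD → IntervalD
  | [] => IntervalD.ofInt 0
  | B :: l => IntervalD.addR prec B (sumBoxes prec l)

/-- A list sum lies in the rounded sum of boxes containing its terms. [folklore] -/
theorem mem_sumBoxes {τ : Type*} (prec : ℕ) (F : τ → ℝ) (B : τ → IntervalD) :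
    ∀ l : List τ, (∀ t ∈ l, IntervalD.mem (F t) (B t)) → IntervalD.mem ((l.map F).sum) (sumBoxes prec (l.map B))
  | [], _ => by simpa [sumBoxes] using IntervalD.mem_ofInt 0
  | t :: l, h => by
    rw [List.map_cons, List.sum_cons, List.map_cons]
    exact IntervalD.mem_addR prec (h t List.mem_cons_self)
      (mem_sumBoxes prec F B l fun s hs => h s (List.mem_cons_of_mem t hs))

/-! ### The weighted coordinate reader -/

variable {ω : Fin m → ℤ → ℝ}

/-- On the window, the truncated per-component weighted state is weight × coordinate. [folklore] -/
theorem truncAt_pwstate_of_mem (x : Fin (m * winLen Kb Ka) → ℝ) (i : Fin m) {n : ℤ} (h : -Kb ≤ n ∧ n ≤ Ka) :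
    truncAt Kb Ka (pwstate Kb Ka ω (x ∘ finProdFinEquiv)) i n = ω i n * x (idxOf Kb Ka i n h) := by
  unfold truncAt pwstate idxOf
  rw [if_pos h, dif_pos h]
  rfl

/-- Off the window, the truncated state vanishes. [folklore] -/
theorem truncAt_pwstate_of_not (x : Fin (m * winLen Kb Ka) → ℝ) (i : Fin m) {n : ℤ} (h : ¬(-Kb ≤ n ∧ n ≤ Ka)) :
    truncAt Kb Ka (pwstate Kb Ka ω (x ∘ finProdFinEquiv)) i n = 0 := by
  unfold truncAt; rw [if_neg h]

/-! ### The interval twin of the field -/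

/-- The real coefficient of the monomial `(i₁, i₂, μ)` of target `(i, k)` in per-component weighted coordinates:
`α i₁ i₂ i μ · (1+ε₀)^{5(k−μ₃)/2} · (ω i₁ a · ω i₂ b / ω i k)`, `a = k−μ₃+μ₁`, `b = k−μ₃+μ₂`.
[cite: Tao2016AveragedNS, §4 (4.8); cell certificate format, checker field] -/
noncomputable def pcoef (ε₀ : ℝ) (α : Fin m → Fin m → Fin m → ℤ × ℤ × ℤ → ℝ) (ω : Fin m → ℤ → ℝ) (i : Fin m) (k : ℤ)
    (i₁ i₂ : Fin m) (μ : ℤ × ℤ × ℤ) : ℝ :=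
  α i₁ i₂ i μ * (1 + ε₀) ^ ((5 : ℝ) * (k - μ.2.2) / 2) * (ω i₁ (k - μ.2.2 + μ.1) * ω i₂ (k - μ.2.2 + μ.2.1) / ω i k)

/-- **Coefficient boxes are sound**: on the window, for the listed shifts, the box contains the real coefficient.
(Supplied by the certificate; a checker recomputes them from `α`, `ε₀`, `ω` with a certified `√`.)
[cite: Tao2016AveragedNS, §4 (4.8); cell certificate format, checker field] -/
def CoefBoxOK (shifts : List (ℤ × ℤ × ℤ)) (ε₀ : ℝ) (α : Fin m → Fin m → Fin m → ℤ × ℤ × ℤ → ℝ) (Kb Ka : ℤ)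
    (ω : Fin m → ℤ → ℝ) (coefB : Fin m → ℤ → Fin m → Fin m → ℤ × ℤ × ℤ → IntervalD) : Prop :=
  ∀ (i : Fin m) (k : ℤ) (i₁ i₂ : Fin m) (μ : ℤ × ℤ × ℤ), μ ∈ shifts → -Kb ≤ k → k ≤ Ka →
    IntervalD.mem (pcoef ε₀ α ω i k i₁ i₂ μ) (coefB i k i₁ i₂ μ)

/-- The box of one monomial: `coefB · U(idx(i₁,a)) · W(idx(i₂,b))`, the zero box if a factor is off the window.
[folklore] -/
def termBox (Kb Ka : ℤ) (prec : ℕ) (coefB : Fin m → ℤ → Fin m → Fin m → ℤ × ℤ × ℤ → IntervalD)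
    (U W : Fin (m * winLen Kb Ka) → IntervalD) (i : Fin m) (k : ℤ) (i₁ i₂ : Fin m) (μ : ℤ × ℤ × ℤ) : IntervalD :=
  if ha : -Kb ≤ k - μ.2.2 + μ.1 ∧ k - μ.2.2 + μ.1 ≤ Ka then
    if hb : -Kb ≤ k - μ.2.2 + μ.2.1 ∧ k - μ.2.2 + μ.2.1 ≤ Ka then
      IntervalD.mulR prec (IntervalD.mulR prec (coefB i k i₁ i₂ μ) (U (idxOf Kb Ka i₁ (k - μ.2.2 + μ.1) ha)))
        (W (idxOf Kb Ka i₂ (k - μ.2.2 + μ.2.1) hb))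
    else IntervalD.ofInt 0
  else IntervalD.ofInt 0

/-- **THE INTERVAL TWIN OF THE WINDOW FIELD** `PQcN`: coordinate `d ↔ (i, k)` carries the rounded sum of the monomial
boxes over `(i₁, i₂, μ) ∈ Fin m × Fin m × shifts`. [cite: Tao2016AveragedNS, §4 (4.8); cell certificate format, checker field] -/
def pqBox (Kb Ka : ℤ) (prec : ℕ) (shifts : List (ℤ × ℤ × ℤ))
    (coefB : Fin m → ℤ → Fin m → Fin m → ℤ × ℤ × ℤ → IntervalD)
    (U W : Fin (m * winLen Kb Ka) → IntervalD) (d : Fin (m * winLen Kb Ka)) : IntervalD :=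
  let ic := finProdFinEquiv.symm d
  let k : ℤ := shellAt Kb ic.2
  sumBoxes prec ((List.finRange m).map fun i₁ => sumBoxes prec ((List.finRange m).map fun i₂ =>
    sumBoxes prec (shifts.map fun μ => termBox Kb Ka prec coefB U W ic.1 k i₁ i₂ μ)))

/-! ### Soundness -/

variable {𝕊 : Finset (ℤ × ℤ × ℤ)} {ε₀ : ℝ} {α : Fin m → Fin m → Fin m → ℤ × ℤ × ℤ → ℝ}
  {shifts : List (ℤ × ℤ × ℤ)} {prec : ℕ} {coefB : Fin m → ℤ → Fin m → Fin m → ℤ × ℤ × ℤ → IntervalD}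

/-- One monomial: the real term, divided by the target weight, lies in its box. [folklore] -/
theorem mem_termBox (hcoef : CoefBoxOK shifts ε₀ α Kb Ka ω coefB)
    {x y : Fin (m * winLen Kb Ka) → ℝ} {U W : Fin (m * winLen Kb Ka) → IntervalD}
    (hx : ∀ d, IntervalD.mem (x d) (U d)) (hy : ∀ d, IntervalD.mem (y d) (W d))
    (i : Fin m) {k : ℤ} (hk1 : -Kb ≤ k) (hk2 : k ≤ Ka) (i₁ i₂ : Fin m) {μ : ℤ × ℤ × ℤ} (hμ : μ ∈ shifts) :
    IntervalD.mem
      (α i₁ i₂ i μ * (1 + ε₀) ^ ((5 : ℝ) * (k - μ.2.2) / 2) *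
        (truncAt Kb Ka (pwstate Kb Ka ω (x ∘ finProdFinEquiv)) i₁ (k - μ.2.2 + μ.1) *
          truncAt Kb Ka (pwstate Kb Ka ω (y ∘ finProdFinEquiv)) i₂ (k - μ.2.2 + μ.2.1)) / ω i k)
      (termBox Kb Ka prec coefB U W i k i₁ i₂ μ) := by
  unfold termBox
  by_cases ha : -Kb ≤ k - μ.2.2 + μ.1 ∧ k - μ.2.2 + μ.1 ≤ Ka
  · by_cases hb : -Kb ≤ k - μ.2.2 + μ.2.1 ∧ k - μ.2.2 + μ.2.1 ≤ Ka
    · rw [dif_pos ha, dif_pos hb, truncAt_pwstate_of_mem x i₁ ha, truncAt_pwstate_of_mem y i₂ hb]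
      have hval : α i₁ i₂ i μ * (1 + ε₀) ^ ((5 : ℝ) * (k - μ.2.2) / 2) *
          (ω i₁ (k - μ.2.2 + μ.1) * x (idxOf Kb Ka i₁ (k - μ.2.2 + μ.1) ha) *
            (ω i₂ (k - μ.2.2 + μ.2.1) * y (idxOf Kb Ka i₂ (k - μ.2.2 + μ.2.1) hb))) / ω i k =
          pcoef ε₀ α ω i k i₁ i₂ μ * x (idxOf Kb Ka i₁ (k - μ.2.2 + μ.1) ha) *
            y (idxOf Kb Ka i₂ (k - μ.2.2 + μ.2.1) hb) := by
        unfold pcoef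
        field_simp
      rw [hval]
      exact IntervalD.mem_mulR prec (IntervalD.mem_mulR prec (hcoef i k i₁ i₂ μ hμ hk1 hk2) (hx _)) (hy _)
    · rw [dif_pos ha, dif_neg hb, truncAt_pwstate_of_not y i₂ hb, mul_zero, mul_zero, zero_div]
      simpa using IntervalD.mem_ofInt 0
  · rw [dif_neg ha, truncAt_pwstate_of_not x i₁ ha, zero_mul, mul_zero, zero_div]
    simpa using IntervalD.mem_ofInt 0

/-- **THE TWIN ENCLOSES THE FIELD**: `PQcN 𝕊 ε₀ α Kb Ka ω x y d ∈ pqBox … U W d` when `x ∈ U`, `y ∈ W` coordinatewise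
(`𝕊 = shifts.toFinset`, `shifts` without duplicates, sound coefficient boxes).
[cite: Tao2016AveragedNS, §4 (4.8); cell certificate format, checker field] -/
theorem mem_pqBox (hKb : 0 ≤ Kb) (hKa : 1 ≤ Ka) (hnd : shifts.Nodup)
    (hcoef : CoefBoxOK shifts ε₀ α Kb Ka ω coefB)
    {x y : Fin (m * winLen Kb Ka) → ℝ} {U W : Fin (m * winLen Kb Ka) → IntervalD}
    (hx : ∀ d, IntervalD.mem (x d) (U d)) (hy : ∀ d, IntervalD.mem (y d) (W d)) (d : Fin (m * winLen Kb Ka)) :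
    IntervalD.mem (PQcN shifts.toFinset ε₀ α Kb Ka ω x y d) (pqBox Kb Ka prec shifts coefB U W d) := by
  have hKK : 0 ≤ Ka + Kb + 1 := by omega
  obtain ⟨hk1, hk2⟩ := shellAt_mem hKK (finProdFinEquiv.symm d).2
  set i := (finProdFinEquiv.symm d).1 with hi
  set k := shellAt Kb (finProdFinEquiv.symm d).2 with hk
  -- the field as a triple list sum of weight-divided monomials
  have hval : PQcN shifts.toFinset ε₀ α Kb Ka ω x y d =
      (((List.finRange m).map fun i₁ => ((List.finRange m).map fun i₂ => (shifts.map fun μ =>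
        α i₁ i₂ i μ * (1 + ε₀) ^ ((5 : ℝ) * (k - μ.2.2) / 2) *
          (truncAt Kb Ka (pwstate Kb Ka ω (x ∘ finProdFinEquiv)) i₁ (k - μ.2.2 + μ.1) *
            truncAt Kb Ka (pwstate Kb Ka ω (y ∘ finProdFinEquiv)) i₂ (k - μ.2.2 + μ.2.1)) / ω i k).sum).sum)).sum := by
    simp only [PQcN, PQc, pwcoord, biFieldOn, ← hi, ← hk]
    rw [Finset.sum_div, Fin.sum_univ_def]
    refine congrArg List.sum (List.map_congr_left fun i₁ _ => ?_)
    rw [Finset.sum_div, Fin.sum_univ_def]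
    refine congrArg List.sum (List.map_congr_left fun i₂ _ => ?_)
    rw [Finset.sum_div, List.sum_toFinset _ hnd]
  rw [hval]
  unfold pqBox
  simp only [← hi, ← hk]
  refine mem_sumBoxes prec _ _ (List.finRange m) fun i₁ _ => ?_
  refine mem_sumBoxes prec _ _ (List.finRange m) fun i₂ _ => ?_
  exact mem_sumBoxes prec _ _ shifts fun μ hμ => mem_termBox hcoef hx hy i hk1 hk2 i₁ i₂ hμ

/-- **`pqBox` IS AN INTERVAL EXTENSION OF `PQcN`** in the sense of pub-ns-dss's jet theory (coordinates read by
evaluation). [cite: Tao2016AveragedNS, §4 (4.8); cell certificate format, checker field] -/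
theorem isFieldEnclosure_pqBox (hKb : 0 ≤ Kb) (hKa : 1 ≤ Ka) (hnd : shifts.Nodup)
    (hcoef : CoefBoxOK shifts ε₀ α Kb Ka ω coefB) :
    IntervalD.IsFieldEnclosure (fun (v : Fin (m * winLen Kb Ka) → ℝ) (d : Fin (m * winLen Kb Ka)) => v d)
      (PQcN shifts.toFinset ε₀ α Kb Ka ω) (pqBox Kb Ka prec shifts coefB) :=
  fun _ _ _ _ hx hy d => mem_pqBox hKb hKa hnd hcoef hx hy d

/-- **JETS OF THE WINDOW FIELD ARE ENCLOSED**: any jet-enclosure family `J` (levels `0..K`) built with `pqBox` encloses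
the Taylor jets `taylorJet (PQcN …) y k` of every point `y` of its level-`0` box (pub-ns-dss's
`mem_jet_of_isJetEnclosure`; the `TPoly` / `VPoly` clauses of the step checker start here).
[cite: Tao2016AveragedNS, §4 (4.8); cell certificate format, checker field] -/
theorem mem_taylorJet_pqBox (hKb : 0 ≤ Kb) (hKa : 1 ≤ Ka) (hnd : shifts.Nodup)
    (hcoef : CoefBoxOK shifts ε₀ α Kb Ka ω coefB) {K : ℕ} {J : ℕ → Fin (m * winLen Kb Ka) → IntervalD}
    (hJ : IntervalD.IsJetEnclosure (pqBox Kb Ka prec shifts coefB) prec K J)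
    {y : Fin (m * winLen Kb Ka) → ℝ} (hy : ∀ d, IntervalD.mem (y d) (J 0 d)) :
    ∀ k ≤ K, ∀ d, IntervalD.mem (taylorJet (PQcN shifts.toFinset ε₀ α Kb Ka ω) y k d) (J k d) :=
  IntervalD.mem_jet_of_isJetEnclosure (rd := fun (v : Fin (m * winLen Kb Ka) → ℝ) d => v d)
    (T := taylorJet (PQcN shifts.toFinset ε₀ α Kb Ka ω)) (fun _ _ => rfl)
    (fun x k c => taylorJet_succ_apply _ x k c) (isFieldEnclosure_pqBox hKb hKa hnd hcoef) hJ hy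

end CertificateGlueOn

end Summit.NavierStokesRegularity.NavierStokesRegularity.Theorems
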